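import Mathlib.RingTheory.AlgebraicIndependent.TranscendenceBasis
import Mathlib.RingTheory.MvPolynomial.Tower
import Mathlib.LinearAlgebra.FiniteDimensional.Lemmas
import Mathlib.LinearAlgebra.Dimension.Constructions
import Literature.NumberTheory.Transcendental.KhovanskiiDichotomy
import Literature.NumberTheory.Transcendental.AxSchanuelProofs
import Literature.NumberTheory.Transcendental.EclPregeometry
import Literature.NumberTheory.Transcendental.EclClosureOperatorProofs
import Literature.NumberTheory.Transcendental.KirbyWeakSchanuel
import Literature.NumberTheory.Transcendental.KirbyRelativeSchanuel
import Literature.NumberTheory.Transcendental.KirbyWeakSchanuelProofs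
import Literature.NumberTheory.Transcendental.GammaFields
import Literature.NumberTheory.Transcendental.RosenlichtProp4Residues
import HarnessLib

/-!
# Kirby's weak Schanuel property from the weak form of Ax's theorem

Trunk T-TRANSCEND (`Literature/NumberTheory/Transcendental`). Proofs file for the named facts
`Literature.Kirby2010_weakSchanuel K` (`EclPregeometry.lean`; J. Kirby, *Exponential algebraicity in
exponential fields*, Bull. Lond. Math. Soc. 42 (2010), Thm. 1.2 in the form `δ(x̄/C) ≥ 0`) and
`Literature.NumberTheory.Transcendental.kirby_weakSchanuel_ecl_empty` (`KirbyWeakSchanuel.lean`; the case `K = ℂ_exp`,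
`C = ecl ∅`).

Kirby derives Thm. 1.2 (p. 11: "theorem 1.2 follows from corollary 5.2") from Ax's theorem
[Ax 1971, Thm. 3 = Kirby Thm. 5.1] applied to the E-derivations of the whole field over `C`,
which requires `cl = ecl` (Thm. 1.1, whose hard half Prop. 7.1 rests on the extension theory of
§§5–6). Here we give a proof of Thm. 1.2 (form `δ ≥ 0`, fields in `Type`) which needs from Ax's theorem
only the tree's named fact `Literature.NumberTheory.Transcendental.ax_schanuel` (Ax 1971 Thm. 3 for finitely many
derivations; its rank term is simply dropped), itself reduced in `AxSchanuelProofs.lean` to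
Rosenlicht's Prop. 4 (`Literature.NumberTheory.Transcendental.Rosenlicht.Rosenlicht1976_prop4`), and otherwise only Lemma 3.3
(`ecl C` is an E-subfield, `ecl ecl = ecl`, PROVED in `EclPregeometryProofs`,
`EclClosureOperatorProofs`) and the Khovanskii dichotomy of Lemma 4.8 / Prop. 7.1 (PROVED in
`KhovanskiiDichotomy.lean`), by strong induction on `n`, working inside the finitely generated
field `L = C(x̄, e^{x̄})`:

* if `(x̄, e^{x̄})` solves a Khovanskii system over `C` then `x₁ ∈ ecl C = C`, contradicting the
  linear independence of `x̄` modulo `C` (this is Kirby's proof of Prop. 7.1, last paragraph);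
* otherwise there is a non-zero E-derivation `∂` of `L` over `C` (Lemma 4.8); with `E` its field
  of constants, `m = dim {q ∈ ℚⁿ | q·x̄ ∈ E} < n`, an integral basis `w₁, …, w_m` of this space
  gives `z_k = w_k·x̄ ∈ E` with `e^{z_k} = ∏ (e^{xᵢ})^{w_{ki}} ∈ E`, `z̄` independent modulo `C`,
  so `m ≤ td(z̄, e^{z̄}/C) ≤ trdeg_C E` by induction; a maximal sub-tuple `x̄'` of `x̄` independent
  modulo `E` has `n - m` elements and Ax's theorem for `(L, ∂)` gives `n - m ≤ trdeg_E L`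
  (Kirby Cor. 5.2); the tower law `trdeg_C E + trdeg_E L ≤ trdeg_C L` concludes.

## Contents

* `Literature.NumberTheory.Transcendental.le_relTrdeg_of_isEclClosed` — Kirby 2010 Thm. 1.2 / Cor. 5.2 for `ecl`-closed `C` and
  `x̄` independent modulo `C`, from `ax_schanuel`.
* `Literature.NumberTheory.Transcendental.Kirby2010_weakSchanuel_of_ax`, `Literature.NumberTheory.Transcendental.kirby_weakSchanuel_ecl_empty_of_ax`,
  `Literature.NumberTheory.Transcendental.kirby_relative_schanuel_complex_of_ax`, `Literature.NumberTheory.Transcendental.schanuelConjecture_iff_ecl_empty_of_ax`,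
  and the same four from `Rosenlicht1976_prop4` (`…_of_rosenlicht`, via
  `Transcendental.ax_schanuel_of_rosenlicht`).
* **Discharges** (appended 2026-08-14, once `RosenlichtProp4Residues.lean` proved Rosenlicht's
  Prop. 4 and hence Ax's theorem, `Transcendental.ax_schanuel_holds`):
  `Literature.NumberTheory.Transcendental.kirby_weakSchanuel_ecl_empty_holds` (the target fact of `KirbyWeakSchanuel.lean`
  HOLDS; it lives here and not in `KirbyWeakSchanuelProofs.lean` because this file imports that
  one), `Literature.NumberTheory.Transcendental.schanuelConjecture_iff_ecl_empty_holds`, `Literature.NumberTheory.Transcendental.kirby_relative_schanuel_complex_holds`,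
  `Literature.NumberTheory.Transcendental.Kirby2010_weakSchanuel_complex_holds`, `Literature.NumberTheory.Transcendental.Kirby2010_weakSchanuel_holds_type0`.

## References

* J. Kirby, *Exponential algebraicity in exponential fields*, Bull. Lond. Math. Soc. 42 (2010),
  879–890, arXiv:0810.4285: Thm. 1.2, Lemma 3.3, Lemma 4.8, Thm. 5.1, Cor. 5.2, Prop. 7.1.
* J. Ax, *On Schanuel's conjectures*, Ann. of Math. 93 (1971), 252–268, Thm. 3.
-/

noncomputable section

open Cardinal MvPolynomial

universe u

namespace Literature.NumberTheory.Transcendental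


/-! ### Elementary lemmas -/

section Lemmas

/-- Clearing denominators in a rational vector: `d • v ∈ ℤⁿ` for some integer `d ≥ 1`.
[folklore] -/
theorem exists_nat_mul_eq_intCast {n : ℕ} (v : Fin n → ℚ) :
    ∃ d : ℕ, d ≠ 0 ∧ ∃ w : Fin n → ℤ, ∀ i, (d : ℚ) * v i = w i := by
  classical
  refine ⟨∏ i, (v i).den, ?_, fun i => (∏ j ∈ Finset.univ.erase i, ((v j).den : ℤ)) * (v i).num,
    fun i => ?_⟩
  · exact Finset.prod_ne_zero_iff.mpr fun i _ => (v i).den_nz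
  · rw [← Finset.prod_erase_mul _ _ (Finset.mem_univ i)]
    push_cast
    rw [mul_assoc, Rat.den_mul_eq_num]

variable {L : Type*} [Field L]

/-- For a derivation `D` with `D yᵢ = yᵢ D xᵢ` (`yᵢ ≠ 0`) and integers `wᵢ`:
`D(∏ yᵢ^{wᵢ}) = (∏ yᵢ^{wᵢ}) · D(∑ wᵢ xᵢ)` ("`e^{∑ wᵢxᵢ} = ∏ (e^{xᵢ})^{wᵢ}` is again an
exponential pair"); from the logarithmic-derivative formula
`Transcendental.inv_mul_derivation_prod_zpow` of `AxSchanuelProofs.lean`.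
[cite: Kirby2010, Def. 4.1] -/
theorem derivation_prod_zpow_of_exp {R : Type*} [CommRing R] [Algebra R L] (D : Derivation R L L)
    {n : ℕ} (x y : Fin n → L) (hy : ∀ i, y i ≠ 0) (hD : ∀ i, D (y i) = y i * D (x i))
    (w : Fin n → ℤ) :
    D (∏ i, y i ^ w i) = (∏ i, y i ^ w i) * D (∑ i, (w i : L) * x i) := by
  have hP : (∏ i, y i ^ w i) ≠ 0 :=
    Finset.prod_ne_zero_iff.mpr fun i _ => zpow_ne_zero _ (hy i)
  have h := Transcendental.inv_mul_derivation_prod_zpow D Finset.univ y (fun i _ => hy i) w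
  rw [inv_mul_eq_iff_eq_mul₀ hP] at h
  rw [h, map_sum]
  congr 1
  refine Finset.sum_congr rfl fun i _ => ?_
  rw [Derivation.leibniz, D.map_intCast, smul_zero, add_zero, smul_eq_mul, hD i,
    inv_mul_cancel_left₀ (hy i)]

variable [Literature.ModelTheory.ExponentialFields.ExponentialRing L]

/-- `exp (∑ wᵢ xᵢ) = ∏ (exp xᵢ)^{wᵢ}` for integers `wᵢ` (from `ExponentialRing.exp_zsmul` of
`GammaFields.lean`). [folklore] -/
theorem exp_sum_intCast_mul {n : ℕ} (w : Fin n → ℤ) (x : Fin n → L) :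
    Literature.ModelTheory.ExponentialFields.ExponentialRing.exp (∑ i, (w i : L) * x i) = ∏ i, Literature.ModelTheory.ExponentialFields.ExponentialRing.exp (x i) ^ w i := by
  classical
  have : ∀ s : Finset (Fin n), Literature.ModelTheory.ExponentialFields.ExponentialRing.exp (∑ i ∈ s, (w i : L) * x i) =
      ∏ i ∈ s, Literature.ModelTheory.ExponentialFields.ExponentialRing.exp (x i) ^ w i := by
    intro s
    induction s using Finset.induction_on with
    | empty => simp
    | insert a s ha ih =>
      rw [Finset.sum_insert ha, Finset.prod_insert ha, Literature.ModelTheory.ExponentialFields.ExponentialRing.exp_add, ih, ← zsmul_eq_mul,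
        Literature.ModelTheory.ExponentialFields.ExponentialRing.exp_zsmul]
  exact this Finset.univ

end Lemmas

/-! ### Transcendence degree: a tower inequality with the middle field given as a subring -/

section Tower

/-- Tower inequality `trdeg_F N + trdeg_E L ≤ trdeg_F L` for intermediate fields `N ≤ L` of
`K/F` and a subring `E` of `L` containing (the images of) `F` and `N` (Mathlib's `trdeg_add_le`,
with the `F`-algebra structure on `E` supplied locally). [folklore] -/
theorem trdeg_add_le_of_le_subring {F K : Type u} [Field F] [Field K] [Algebra F K]
    (L N : IntermediateField F K) (hle : N ≤ L) (E : Subring L)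
    (hFE : ∀ c : F, algebraMap F L c ∈ E) (hNE : ∀ (t : K) (ht : t ∈ N), (⟨t, hle ht⟩ : L) ∈ E) :
    Algebra.trdeg F N + Algebra.trdeg E L ≤ Algebra.trdeg F L := by
  letI alg : Algebra F E := ((algebraMap F L).codRestrict E hFE).toAlgebra
  have halg : ∀ c : F, (algebraMap F E c : L) = algebraMap F L c := fun _ => rfl
  haveI : IsScalarTower F E L := IsScalarTower.of_algebraMap_eq fun c => (halg c).symm
  haveI : FaithfulSMul F E := (faithfulSMul_iff_algebraMap_injective F E).mpr fun a b hab => by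
    have := congrArg ((↑) : E → L) hab
    rw [halg, halg] at this
    exact (algebraMap F L).injective this
  haveI : FaithfulSMul E L :=
    (faithfulSMul_iff_algebraMap_injective E L).mpr fun a b hab => Subtype.ext hab
  let ι' : N →ₐ[F] E :=
    { toFun := fun t => ⟨⟨t, hle t.2⟩, hNE t t.2⟩
      map_one' := rfl
      map_mul' := fun _ _ => rfl
      map_zero' := rfl
      map_add' := fun _ _ => rfl
      commutes' := fun _ => rfl }
  have hι' : Function.Injective ι' := fun a b hab => by
    have := congrArg (fun t : E => ((t : L) : K)) hab
    exact Subtype.ext this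
  calc Algebra.trdeg F N + Algebra.trdeg E L
      ≤ Algebra.trdeg F E + Algebra.trdeg E L := by
        gcongr
        exact trdeg_le_of_injective ι' hι'
    _ ≤ Algebra.trdeg F L := trdeg_add_le

end Tower

/-! ### Kirby's theorem 1.2 for tuples independent modulo an `ecl`-closed set -/

section Induction

variable {K : Type u} [Field K] [CharZero K] [Literature.ModelTheory.ExponentialFields.ExponentialRing K]

/-- The exponential partial derivative commutes with a change of coefficient ring. [folklore] -/
theorem Khovanskii.ePD_map {R S : Type*} [Field R] [Field S] (φ : R →+* S) {n : ℕ} (j : Fin n)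
    (p : MvPolynomial (Fin n ⊕ Fin n) R) :
    Khovanskii.ePD j (MvPolynomial.map φ p) = MvPolynomial.map φ (Khovanskii.ePD j p) := by
  simp only [Khovanskii.ePD, pderiv_map, map_add, map_mul, map_X]

/-- For an `ecl`-closed `C` (a subfield, Kirby Lemma 3.3), `ℚ(C) ⊆ C`. [cite: Kirby2010, Lemma 3.3] -/
theorem adjoin_rat_le_of_isEclClosed {C : Set K} (hC : IsEclClosed C) {a : K}
    (ha : a ∈ IntermediateField.adjoin ℚ C) : a ∈ C := by
  have hle : IntermediateField.adjoin ℚ C ≤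
      (Khovanskii.eclSubfield C).toIntermediateField
        (fun q => SubfieldClass.ratCast_mem (Khovanskii.eclSubfield C) q) := by
    rw [IntermediateField.adjoin_le_iff]
    intro c hc
    exact subset_ecl C hc
  have h : a ∈ ecl C := hle ha
  rwa [hC] at h

end Induction

section Main

-- one long elementary induction step (Kirby's proof of Thm. 1.2 inside `C(x̄, e^{x̄})`); splitting it
-- into lemmas would mean threading a dozen `set` abbreviations through their statements
set_option maxHeartbeats 400000 in
/-- **Kirby 2010, Thm. 1.2 (form `δ(x̄/C) ≥ 0`), for tuples independent modulo `C`,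
from Ax's theorem.** If `C ⊆ K` is `ecl`-closed and `x : Fin n → K` is
`ℚ`-linearly independent modulo `⟨C⟩_ℚ`, then `n ≤ td(x̄, exp x̄ / C)`. Strong induction on `n`
inside `L = ℚ(C)(x̄, e^{x̄})` via the Khovanskii dichotomy: a Khovanskii system would put `x₁`
in `ecl C = C`; otherwise a non-zero E-derivation `∂` of `L` over `C` with constants `E`
splits `n = m + n'` with `m ≤ trdeg_C E` (induction, through an integral basis of
`{q | q·x̄ ∈ E}`) and `n' ≤ trdeg_E L` (Ax; the rank term is dropped), and the tower law
concludes. Fields in `Type` (the universe of the named fact `ax_schanuel`).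
[cite: Kirby2010, Thm. 1.2 and Cor. 5.2] -/
theorem le_relTrdeg_of_isEclClosed {K : Type} [Field K] [CharZero K] [Literature.ModelTheory.ExponentialFields.ExponentialRing K]
    (hAx : Transcendental.ax_schanuel) {C : Set K} (hC : IsEclClosed C) :
    ∀ (n : ℕ) (x : Fin n → K), LinearIndependent ℚ ((Submodule.span ℚ C).mkQ ∘ x) →
      (n : Cardinal) ≤ relTrdeg C x := by
  intro n
  induction n using Nat.strong_induction_on with
  | _ n ih =>
  intro x hx
  classical
  rcases Nat.eq_zero_or_pos n with rfl | hn
  · simp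
  -- the base field `F = ℚ(C)` (`= C`) and the field `L = F(x̄, e^{x̄})`
  set F : IntermediateField ℚ K := IntermediateField.adjoin ℚ C with hF
  have hFC : ∀ c : F, (c : K) ∈ C := fun c => adjoin_rat_le_of_isEclClosed hC c.2
  set S : Set K := Set.range x ∪ Set.range (Literature.ModelTheory.ExponentialFields.ExponentialRing.exp ∘ x) with hS
  set L : IntermediateField F K := IntermediateField.adjoin F S with hL
  change (n : Cardinal) ≤ Algebra.trdeg F L
  have hxS : ∀ i, x i ∈ L := fun i => IntermediateField.subset_adjoin F S (Or.inl ⟨i, rfl⟩)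
  have hyS : ∀ i, Literature.ModelTheory.ExponentialFields.ExponentialRing.exp (x i) ∈ L := fun i =>
    IntermediateField.subset_adjoin F S (Or.inr ⟨i, rfl⟩)
  set xL : Fin n → L := fun i => ⟨x i, hxS i⟩ with hxL
  set yL : Fin n → L := fun i => ⟨Literature.ModelTheory.ExponentialFields.ExponentialRing.exp (x i), hyS i⟩ with hyL
  have hy0 : ∀ i, yL i ≠ 0 := fun i h =>
    (Literature.ModelTheory.ExponentialFields.ExponentialRing.isUnit_exp (x i)).ne_zero (congrArg Subtype.val h)
  have htopL : IntermediateField.adjoin F (Set.range xL ∪ Set.range yL) = ⊤ := by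
    have h := IntermediateField.adjoin_preimage_val_eq_top (F := F) S
    have hpre : Set.range xL ∪ Set.range yL = ((↑) : L → K) ⁻¹' S := by
      ext t
      simp only [Set.mem_union, Set.mem_range, Set.mem_preimage, hS, Function.comp_apply]
      constructor
      · rintro (⟨i, rfl⟩ | ⟨i, rfl⟩)
        · exact Or.inl ⟨i, rfl⟩
        · exact Or.inr ⟨i, rfl⟩
      · rintro (⟨i, hi⟩ | ⟨i, hi⟩)
        · exact Or.inl ⟨i, Subtype.ext hi⟩
        · exact Or.inr ⟨i, Subtype.ext hi⟩
    rw [hpre]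
    exact h
  set zL : Fin n ⊕ Fin n → L := Sum.elim xL yL with hzL
  rcases khovanskii_dichotomy xL yL htopL with ⟨g, hg0, hdet⟩ | ⟨D, hDE, j₀, hj₀⟩
  · /- (a) `x̄` solves a Khovanskii system over `C`: impossible -/
    exfalso
    simp only [← hzL] at hg0 hdet
    have hkpt : Khovanskii.kpt x = algebraMap L K ∘ zL := by
      funext s; rcases s with i | i <;> rfl
    have heval : ∀ p : MvPolynomial (Fin n ⊕ Fin n) F,
        MvPolynomial.eval (Khovanskii.kpt x) (MvPolynomial.map (algebraMap F K) p) =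
          algebraMap L K (aeval zL p) := by
      intro p
      rw [MvPolynomial.eval_map, ← MvPolynomial.aeval_def, hkpt, MvPolynomial.aeval_algebraMap_apply]
    set f : Fin n → MvPolynomial (Fin n ⊕ Fin n) K := fun i => MvPolynomial.map (algebraMap F K) (g i)
      with hf
    have hsol : Khovanskii.IsSol C x f :=
      { coeff := fun i => Khovanskii.mem_polyOver_iff.mpr fun mo => by
          simp only [hf, MvPolynomial.coeff_map]
          exact Subring.subset_closure (hFC _)
        eval_eq := fun i => by
          simp only [hf]
          rw [heval, hg0 i, map_zero]
        det_ne := by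
          have hJ : Khovanskii.kjac x f =
              (algebraMap L K).mapMatrix (Matrix.of fun i j => aeval zL (Khovanskii.ePD j (g i))) := by
            ext i j
            simp only [Khovanskii.kjac, Matrix.of_apply, RingHom.mapMatrix_apply, Matrix.map_apply, hf]
            rw [Khovanskii.ePD_map, heval]
          rw [hJ, ← RingHom.map_det, map_ne_zero]
          exact hdet }
    have hmem : x ⟨0, hn⟩ ∈ ecl C :=
      Khovanskii.mem_ecl_iff.mpr ⟨Fin n, inferInstance, inferInstance, x, f, hsol, ⟨0, hn⟩, rfl⟩
    have hC' : ecl C = C := hC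
    rw [hC'] at hmem
    have h0 : ((Submodule.span ℚ C).mkQ ∘ x) ⟨0, hn⟩ = 0 := by
      simp only [Function.comp_apply, Submodule.mkQ_apply, Submodule.Quotient.mk_eq_zero]
      exact Submodule.subset_span hmem
    exact hx.ne_zero ⟨0, hn⟩ h0
  · /- (b) a non-zero E-derivation `D` of `L` over `F` -/
    -- `D` as a `ℤ`-derivation, its constants `CD`
    set Dz : Derivation ℤ L L := D.restrictScalars ℤ with hDz
    set D1 : Fin 1 → Derivation ℤ L L := fun _ => Dz with hD1
    set CD : Subring L := Transcendental.constantSubring D1 with hCD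
    have hmemCD : ∀ a : L, a ∈ CD ↔ D a = 0 := fun a => by
      simp only [hCD, hD1, hDz, Transcendental.mem_constantSubring, forall_const]
      exact Iff.rfl
    have hFCD : ∀ c : F, algebraMap F L c ∈ CD := fun c => (hmemCD _).mpr (D.map_algebraMap c)
    -- the elements of `L` killed by `D`, as a `ℚ`-subspace `N` of `K`
    set N : Submodule ℚ K := Submodule.restrictScalars ℚ
      ((LinearMap.ker (D : L →ₗ[F] L)).map (IsScalarTower.toAlgHom F L K).toLinearMap) with hN
    have hmemN : ∀ a : K, a ∈ N ↔ ∃ l : L, D l = 0 ∧ (l : K) = a := fun a => by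
      simp only [hN, Submodule.restrictScalars_mem, Submodule.mem_map, LinearMap.mem_ker]
      constructor
      · rintro ⟨l, hl, rfl⟩; exact ⟨l, hl, rfl⟩
      · rintro ⟨l, hl, rfl⟩; exact ⟨l, hl, rfl⟩
    -- the dependence space `V = {q ∈ ℚⁿ | q·x̄ ∈ N}` and the splitting `n = n' + m`
    set T : (Fin n → ℚ) →ₗ[ℚ] K := Fintype.linearCombination ℚ x with hT
    have hTapply : ∀ v : Fin n → ℚ, T v = ∑ i, v i • x i := fun v =>
      Fintype.linearCombination_apply ℚ x v
    set V : Submodule ℚ (Fin n → ℚ) := N.comap T with hV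
    set T' : (Fin n → ℚ) →ₗ[ℚ] K ⧸ N := N.mkQ ∘ₗ T with hT'
    have hker : LinearMap.ker T' = V := by rw [hT', LinearMap.ker_comp, Submodule.ker_mkQ]
    obtain ⟨κ, a, ha, hspan, hli⟩ := exists_linearIndependent' ℚ ((Submodule.mkQ N) ∘ x)
    haveI : Fintype κ := Fintype.ofInjective a ha
    set n' := Fintype.card κ with hn'
    set e := Fintype.equivFin κ with he
    have hrange : Module.finrank ℚ (LinearMap.range T') = n' := by
      have h1 : LinearMap.range T' = Submodule.span ℚ (Set.range (N.mkQ ∘ x)) := by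
        rw [hT', LinearMap.range_comp, hT, Fintype.range_linearCombination, Submodule.map_span,
          ← Set.range_comp]
      rw [h1, ← hspan, finrank_span_eq_card hli]
    set m := Module.finrank ℚ V with hm
    have hnm : n' + m = n := by
      have := LinearMap.finrank_range_add_finrank_ker T'
      rwa [hrange, hker, Module.finrank_fin_fun] at this
    have hmn : m < n := by
      by_contra hmn'
      have hmn2 : m = n := le_antisymm (by omega) (not_lt.mp hmn')
      have hVtop : V = ⊤ :=
        Submodule.eq_top_of_finrank_eq (by rw [← hm, hmn2, Module.finrank_fin_fun])
      have hmemV : (Pi.single j₀ (1 : ℚ) : Fin n → ℚ) ∈ V := hVtop ▸ Submodule.mem_top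
      rw [hV, Submodule.mem_comap, hT, Fintype.linearCombination_apply_single, one_smul] at hmemV
      obtain ⟨l, hl0, hl⟩ := (hmemN _).mp hmemV
      have hlx : l = xL j₀ := Subtype.ext hl
      rw [hlx] at hl0
      exact hj₀ hl0
    -- Ax's theorem for a maximal sub-tuple `x̄'` of `x̄` independent modulo `N`
    set x' : Fin n' → L := fun i => xL (a (e.symm i)) with hx'
    set y' : Fin n' → L := fun i => yL (a (e.symm i)) with hy'
    have hind : Transcendental.IsQLinearIndependentMod D1 x' := by
      intro q hq
      have hD0 : D (∑ i, (q i : L) * x' i) = 0 := (hmemCD _).mp hq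
      have hNmem : (∑ i, ((q i : ℚ)) • x (a (e.symm i))) ∈ N := by
        refine (hmemN _).mpr ⟨_, hD0, ?_⟩
        rw [show (∑ i, ((q i : ℚ)) • x (a (e.symm i))) = ∑ i, (q i : K) * x (a (e.symm i)) from
          Finset.sum_congr rfl fun i _ => by rw [Rat.smul_def, Rat.cast_intCast]]
        push_cast
        simp only [hx', hxL]
      have h0 : ∑ i, ((q i : ℤ) : ℚ) • ((N.mkQ ∘ x ∘ a) ∘ e.symm) i = 0 := by
        have h1 : N.mkQ (∑ i, ((q i : ℚ)) • x (a (e.symm i))) = 0 :=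
          (Submodule.Quotient.mk_eq_zero N).mpr hNmem
        rw [map_sum] at h1
        simpa only [map_smul, Function.comp_apply] using h1
      have hli' : LinearIndependent ℚ ((N.mkQ ∘ x ∘ a) ∘ e.symm) := hli.comp e.symm e.symm.injective
      have h2 := Fintype.linearIndependent_iff.mp hli' _ h0
      funext i
      exact_mod_cast h2 i
    have hAxL' := hAx L 1 n' D1 x' y' (fun i => hy0 _) (fun _ i => hDE (a (e.symm i))) hind
    have hAxL := le_trans (Nat.cast_le.mpr (Nat.le_add_right n' _)) hAxL'
    letI algCD : Algebra CD L := Algebra.ofSubsemiring CD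
    have h1 : (n' : Cardinal) ≤ Algebra.trdeg CD L :=
      hAxL.trans (trdeg_le_of_injective (Subalgebra.val _) Subtype.val_injective)
    -- an integral basis of `V` and the tuple `z̄`
    let bV := Module.finBasis ℚ V
    have hint : ∀ k : Fin m, ∃ d : ℕ, d ≠ 0 ∧ ∃ w : Fin n → ℤ,
        ∀ i, (d : ℚ) * ((bV k : V) : Fin n → ℚ) i = w i := fun k => exists_nat_mul_eq_intCast _
    choose d hd w hw using hint
    have huV : ∀ k, (fun i => (w k i : ℚ)) ∈ V := fun k => by
      have : (fun i => (w k i : ℚ)) = (d k : ℚ) • ((bV k : V) : Fin n → ℚ) := by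
        funext i; rw [Pi.smul_apply, smul_eq_mul, hw]
      rw [this]
      exact V.smul_mem _ (bV k).2
    have hli_u : LinearIndependent ℚ (fun k => fun i => (w k i : ℚ)) := by
      have hb : LinearIndependent ℚ (fun k => ((bV k : V) : Fin n → ℚ)) :=
        bV.linearIndependent.map' V.subtype (Submodule.ker_subtype V)
      have hb2 := hb.units_smul fun k => Units.mk0 (d k : ℚ) (Nat.cast_ne_zero.mpr (hd k))
      convert hb2 using 1
      funext k i
      change (w k i : ℚ) = ((Units.mk0 (d k : ℚ) (Nat.cast_ne_zero.mpr (hd k))) •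
        ((bV k : V) : Fin n → ℚ)) i
      rw [Units.smul_def, Units.val_mk0, Pi.smul_apply, smul_eq_mul, hw]
    set z : Fin m → K := fun k => ∑ i, (w k i : K) * x i with hz
    -- `z̄` is independent modulo `C`
    have hzind : LinearIndependent ℚ ((Submodule.span ℚ C).mkQ ∘ z) := by
      rw [Fintype.linearIndependent_iff]
      intro c hc
      have hc1 : ∑ i, (∑ k, c k * (w k i : ℚ)) • ((Submodule.span ℚ C).mkQ ∘ x) i = 0 := by
        rw [← hc]
        simp only [Function.comp_apply, hz, map_sum, Finset.smul_sum, Finset.sum_smul, mul_smul]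
        rw [Finset.sum_comm]
        refine Finset.sum_congr rfl fun k _ => Finset.sum_congr rfl fun i _ => ?_
        rw [← map_smul, ← map_smul, ← map_smul, Rat.smul_def (w k i : ℚ), Rat.cast_intCast]
      have hc2 := Fintype.linearIndependent_iff.mp hx _ hc1
      have hc3 : ∑ k, c k • (fun i => (w k i : ℚ)) = 0 := by
        funext i
        rw [Finset.sum_apply, Pi.zero_apply]
        simpa only [Pi.smul_apply, smul_eq_mul] using hc2 i
      exact Fintype.linearIndependent_iff.mp hli_u c hc3
    -- `z_k ∈ L` and `e^{z_k} ∈ L` are killed by `D`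
    set zLk : Fin m → L := fun k => ∑ i, (w k i : L) * xL i with hzLk
    have hzcoe : ∀ k, ((zLk k : L) : K) = z k := fun k => by
      simp only [hzLk, hz, hxL]
      push_cast
      rfl
    have hDz0 : ∀ k, D (zLk k) = 0 := fun k => by
      obtain ⟨l, hl0, hl⟩ := (hmemN _).mp (Submodule.mem_comap.mp (huV k))
      have hTz : T (fun i => (w k i : ℚ)) = z k := by
        rw [hTapply, hz]
        exact Finset.sum_congr rfl fun i _ => by rw [Rat.smul_def, Rat.cast_intCast]
      have hl' : l = zLk k := Subtype.ext (by rw [hl, hTz, hzcoe])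
      rw [← hl']
      exact hl0
    set ezLk : Fin m → L := fun k => ∏ i, yL i ^ w k i with hezLk
    have hezcoe : ∀ k, ((ezLk k : L) : K) = Literature.ModelTheory.ExponentialFields.ExponentialRing.exp (z k) := fun k => by
      rw [hz]
      dsimp only
      rw [exp_sum_intCast_mul]
      simp only [hezLk, hyL]
      push_cast
      rfl
    have hDez0 : ∀ k, D (ezLk k) = 0 := fun k => by
      simp only [hezLk]
      rw [derivation_prod_zpow_of_exp D xL yL hy0 hDE (w k)]
      have : D (∑ i, (w k i : L) * xL i) = 0 := hDz0 k
      rw [this, mul_zero]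
    -- induction hypothesis for `z̄`
    have hIH : (m : Cardinal) ≤ relTrdeg C z := ih m hmn z hzind
    set Sz : Set K := Set.range z ∪ Set.range (Literature.ModelTheory.ExponentialFields.ExponentialRing.exp ∘ z) with hSz
    set Nz : IntermediateField F K := IntermediateField.adjoin F Sz with hNz
    change (m : Cardinal) ≤ Algebra.trdeg F Nz at hIH
    have hle : Nz ≤ L := by
      rw [hNz, IntermediateField.adjoin_le_iff]
      rintro t (⟨k, rfl⟩ | ⟨k, rfl⟩)
      · rw [← hzcoe]; exact (zLk k).2
      · simp only [Function.comp_apply]; rw [← hezcoe]; exact (ezLk k).2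
    have hιE : ∀ (t : K) (ht : t ∈ Nz), (⟨t, hle ht⟩ : L) ∈ CD := by
      intro t ht
      rw [hmemCD]
      induction ht using IntermediateField.adjoin_induction with
      | mem t ht =>
        rcases ht with ⟨k, rfl⟩ | ⟨k, rfl⟩
        · have h' : (⟨z k, hle (IntermediateField.subset_adjoin F Sz (Or.inl ⟨k, rfl⟩))⟩ : L) =
              zLk k := Subtype.ext (hzcoe k).symm
          rw [h']; exact hDz0 k
        · have h' : (⟨(Literature.ModelTheory.ExponentialFields.ExponentialRing.exp ∘ z) k,
              hle (IntermediateField.subset_adjoin F Sz (Or.inr ⟨k, rfl⟩))⟩ : L) = ezLk k :=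
            Subtype.ext (hezcoe k).symm
          rw [h']; exact hDez0 k
      | algebraMap c => exact D.map_algebraMap c
      | add s t hs ht ihs iht =>
        have h' : (⟨s + t, hle (add_mem hs ht)⟩ : L) = ⟨s, hle hs⟩ + ⟨t, hle ht⟩ := rfl
        rw [h', map_add, ihs, iht, add_zero]
      | inv s hs ihs =>
        have h' : (⟨s⁻¹, hle (inv_mem hs)⟩ : L) = (⟨s, hle hs⟩)⁻¹ := rfl
        rw [h', Derivation.leibniz_inv, ihs, smul_zero]
      | mul s t hs ht ihs iht =>
        have h' : (⟨s * t, hle (mul_mem hs ht)⟩ : L) = ⟨s, hle hs⟩ * ⟨t, hle ht⟩ := rfl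
        rw [h', Derivation.leibniz, ihs, iht, smul_zero, smul_zero, add_zero]
    -- assembling: `n = m + n' ≤ trdeg_F Nz + trdeg_CD L ≤ trdeg_F L`
    have htower := trdeg_add_le_of_le_subring L Nz hle CD hFCD hιE
    calc (n : Cardinal) = (m : Cardinal) + (n' : Cardinal) := by
          rw [← hnm, Nat.cast_add, add_comm]
      _ ≤ Algebra.trdeg F Nz + Algebra.trdeg CD L := add_le_add hIH h1
      _ ≤ Algebra.trdeg F L := htower

end Main


/-! ### Consequences: Kirby's Thm. 1.2 (`δ ≥ 0`) and the target facts from Ax's theorem -/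

section Consequences

/-- **Kirby 2010, Thm. 1.2** in the form `δ(x̄/C) ≥ 0` for `ecl`-closed `C` — the named fact
`Kirby2010_weakSchanuel K` of `EclPregeometry.lean`, for exponential fields `K` in `Type` — from
Ax's theorem `ax_schanuel` alone (no appeal to Prop. 7.1 / Thm. 1.1): reduce an arbitrary tuple to
a maximal sub-tuple independent modulo `⟨C⟩_ℚ` and apply `le_relTrdeg_of_isEclClosed`.
[cite: Kirby2010, Thm. 1.2] -/
theorem Kirby2010_weakSchanuel_of_ax (K : Type) [Field K] [CharZero K] [Literature.ModelTheory.ExponentialFields.ExponentialRing K]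
    (hAx : Transcendental.ax_schanuel) : Kirby2010_weakSchanuel K := by
  intro C hC n x
  classical
  obtain ⟨κ, a, ha, hspan, hli⟩ := exists_linearIndependent' ℚ ((Submodule.span ℚ C).mkQ ∘ x)
  haveI : Fintype κ := Fintype.ofInjective a ha
  set e := Fintype.equivFin κ
  have hli' : LinearIndependent ℚ ((Submodule.span ℚ C).mkQ ∘ ((x ∘ a) ∘ e.symm)) := by
    have : (Submodule.span ℚ C).mkQ ∘ ((x ∘ a) ∘ e.symm) =
        (((Submodule.span ℚ C).mkQ ∘ x) ∘ a) ∘ e.symm := rfl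
    rw [this]
    exact (linearIndependent_equiv e.symm).mpr hli
  have hdim : relLinDim C x = Fintype.card κ := by
    unfold relLinDim
    rw [← hspan]
    exact finrank_span_eq_card hli
  rw [hdim]
  exact (le_relTrdeg_of_isEclClosed hAx hC _ _ hli').trans (relTrdeg_comp_le C x e a)

end Consequences

end Literature.NumberTheory.Transcendental

/-! ### The target fact -/

namespace Literature.NumberTheory.Transcendental

/-- **Kirby's weak Schanuel property over `ecl(∅)` for `ℂ_exp`** (the named fact
`kirby_weakSchanuel_ecl_empty`, Kirby 2010 Thm. 1.2 at `F = ℂ_exp`, `C = ecl ∅`) from Ax's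
theorem `ax_schanuel` ALONE — Kirby's Prop. 7.1 (`Kirby2010_dcl_subset_ecl`), needed in
`kirby_weakSchanuel_ecl_empty_of`, is no longer used: `ecl ∅` is `ecl`-closed (Lemma 3.3,
`isEclClosed_ecl`), so `le_relTrdeg_of_isEclClosed` applies verbatim. [cite: Kirby2010, Thm. 1.2] -/
theorem kirby_weakSchanuel_ecl_empty_of_ax (hAx : Transcendental.ax_schanuel) :
    kirby_weakSchanuel_ecl_empty := by
  intro n x hx
  exact le_relTrdeg_of_isEclClosed hAx (isEclClosed_ecl (∅ : Set ℂ)) n x hx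

/-- `Periods.schanuelConjecture_iff_ecl_empty` (Kirby 2010, §1: Schanuel's conjecture is
equivalent to its restriction to `ecl ∅`) from Ax's theorem alone. [cite: Kirby2010, §1] -/
theorem schanuelConjecture_iff_ecl_empty_of_ax (hAx : Transcendental.ax_schanuel) :
    schanuelConjecture_iff_ecl_empty :=
  schanuelConjecture_iff_ecl_empty_of_weakSchanuel (Kirby2010_weakSchanuel_of_ax ℂ hAx)

/-- The target fact from Rosenlicht's Prop. 4 (`Rosenlicht1976_prop4`, the one transcendence
input of Ax's theorem in the tree: `Transcendental.ax_schanuel_of_rosenlicht`).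
[cite: Kirby2010, Thm. 1.2] -/
theorem kirby_weakSchanuel_ecl_empty_of_rosenlicht (h4 : Rosenlicht.Rosenlicht1976_prop4) :
    kirby_weakSchanuel_ecl_empty :=
  kirby_weakSchanuel_ecl_empty_of_ax (Transcendental.ax_schanuel_of_rosenlicht h4)

/-- `Periods.schanuelConjecture_iff_ecl_empty` from Rosenlicht's Prop. 4. [cite: Kirby2010, §1] -/
theorem schanuelConjecture_iff_ecl_empty_of_rosenlicht (h4 : Rosenlicht.Rosenlicht1976_prop4) :
    schanuelConjecture_iff_ecl_empty :=
  schanuelConjecture_iff_ecl_empty_of_ax (Transcendental.ax_schanuel_of_rosenlicht h4)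

end Literature.NumberTheory.Transcendental

namespace Literature.NumberTheory.Transcendental

/-- `Kirby2010_weakSchanuel ℂ` from Ax's theorem alone. [cite: Kirby2010, Thm. 1.2] -/
theorem Kirby2010_weakSchanuel_complex_of_ax (hAx : Transcendental.ax_schanuel) :
    Kirby2010_weakSchanuel ℂ :=
  Kirby2010_weakSchanuel_of_ax ℂ hAx

/-- The verbatim duplicate `kirby_relative_schanuel_complex` (`KirbyRelativeSchanuel.lean`) from
Ax's theorem alone. [cite: Kirby2010, Thm. 1.2] -/
theorem kirby_relative_schanuel_complex_of_ax (hAx : Transcendental.ax_schanuel) :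
    kirby_relative_schanuel_complex :=
  Transcendental.kirby_weakSchanuel_ecl_empty_of_ax hAx

/-- `Kirby2010_weakSchanuel ℂ` from Rosenlicht's Prop. 4. [cite: Kirby2010, Thm. 1.2] -/
theorem Kirby2010_weakSchanuel_complex_of_rosenlicht (h4 : Rosenlicht.Rosenlicht1976_prop4) :
    Kirby2010_weakSchanuel ℂ :=
  Kirby2010_weakSchanuel_of_ax ℂ (Transcendental.ax_schanuel_of_rosenlicht h4)

/-- `kirby_relative_schanuel_complex` from Rosenlicht's Prop. 4. [cite: Kirby2010, Thm. 1.2] -/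
theorem kirby_relative_schanuel_complex_of_rosenlicht (h4 : Rosenlicht.Rosenlicht1976_prop4) :
    kirby_relative_schanuel_complex :=
  Transcendental.kirby_weakSchanuel_ecl_empty_of_rosenlicht h4

end Literature.NumberTheory.Transcendental

/-! ### Discharges: the target facts hold -/

namespace Literature.NumberTheory.Transcendental

/-- **Kirby's weak Schanuel property over `ecl(∅)` for `ℂ_exp` HOLDS** (the named fact
`kirby_weakSchanuel_ecl_empty` of `KirbyWeakSchanuel.lean`; Kirby 2010, Thm. 1.2 at `F = ℂ_exp`,
`C = ecl ∅`): Rosenlicht's Prop. 4, proved by residues (`Rosenlicht.Rosenlicht1976_prop4_holds`,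
`RosenlichtProp4Residues.lean`), gives Ax's theorem (`Transcendental.ax_schanuel_holds`, Ax 1971
Thm. 3 = Kirby Thm. 5.1), from which Thm. 1.2 follows by `kirby_weakSchanuel_ecl_empty_of_ax`
(strong induction on `n` through the Khovanskii dichotomy of Lemma 4.8 / Prop. 7.1, inside
`C(x̄, e^{x̄})`). [cite: Kirby2010, Thm. 1.2] -/
theorem kirby_weakSchanuel_ecl_empty_holds : kirby_weakSchanuel_ecl_empty :=
  kirby_weakSchanuel_ecl_empty_of_ax Transcendental.ax_schanuel_holds

/-- **Kirby 2010, §1 / Prop. 7.2** — the named fact `Periods.schanuelConjecture_iff_ecl_empty`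
(`SchanuelEclEmpty.lean`: Schanuel's conjecture for `ℂ_exp` is equivalent to its restriction to
tuples from `ecl ∅`, since essential counterexamples lie in `ecl ∅`) HOLDS: by
`schanuelConjecture_iff_ecl_empty_of_ax` (the reduction
`schanuelConjecture_iff_ecl_empty_of_weakSchanuel` of `EclClosureOperatorProofs.lean` fed with
`Kirby2010_weakSchanuel_of_ax ℂ`) and Ax's theorem `Transcendental.ax_schanuel_holds`.
[cite: Kirby2010, Prop. 7.2 and §1] -/
theorem schanuelConjecture_iff_ecl_empty_holds : schanuelConjecture_iff_ecl_empty :=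
  schanuelConjecture_iff_ecl_empty_of_ax Transcendental.ax_schanuel_holds

end Literature.NumberTheory.Transcendental

namespace Literature.NumberTheory.Transcendental

/-- **Kirby 2010, Thm. 1.2 at `F = ℂ_exp`, `C = ecl ∅`** — the named fact
`kirby_relative_schanuel_complex` (`KirbyRelativeSchanuel.lean`) HOLDS: its statement is verbatim
that of `Periods.kirby_weakSchanuel_ecl_empty`. [cite: Kirby2010, Thm. 1.2] -/
theorem kirby_relative_schanuel_complex_holds : kirby_relative_schanuel_complex :=
  Transcendental.kirby_weakSchanuel_ecl_empty_holds

/-- **Kirby 2010, Thm. 1.2** (form `δ(x̄/C) ≥ 0` for `ecl`-closed `C`) for `ℂ_exp`: the instance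
`K = ℂ` of the named fact `Kirby2010_weakSchanuel K` (`EclPregeometry.lean`) HOLDS.
[cite: Kirby2010, Thm. 1.2] -/
theorem Kirby2010_weakSchanuel_complex_holds : Kirby2010_weakSchanuel ℂ :=
  Kirby2010_weakSchanuel_of_ax ℂ Transcendental.ax_schanuel_holds

/-- **Kirby 2010, Thm. 1.2** (form `δ(x̄/C) ≥ 0` for `ecl`-closed `C`) HOLDS for every exponential
field of characteristic zero in `Type`: the named fact `Kirby2010_weakSchanuel K` of
`EclPregeometry.lean` is stated for `K : Type*`, while the tree's Ax theorem
`Transcendental.ax_schanuel` quantifies over fields in `Type`, whence the universe restriction in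
this discharge. [cite: Kirby2010, Thm. 1.2] -/
theorem Kirby2010_weakSchanuel_holds_type0 (K : Type) [Field K] [CharZero K] [Literature.ModelTheory.ExponentialFields.ExponentialRing K] :
    Kirby2010_weakSchanuel K :=
  Kirby2010_weakSchanuel_of_ax K Transcendental.ax_schanuel_holds

end Literature.NumberTheory.Transcendental
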